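import Summits.SmoothPoincare4.SmoothPoincare4.Theorems.RootDecompAEDoublesShadowTwoRoeDefs

/-!
# Grade-two dichotomy for KMN encoding graphs (Roe certificates), part 9/17: unimodular blocks; the tree of pieces

§3 Unimodular finset-indexed square blocks `UM a rows cols` of an integer table (block-triangular splitting
`UM.split_top` / `UM.split_bot`, rank bounds, and the determinant of an enumerated block `UM.isUnit_det_enum`); §5 the
tree of pieces (`tree_facts`, `exists_leaf`, `induce_univ_connected`).

THE FAMILY (16 modules `Theorems/RootDecompAEDoublesShadowTwoRoe*.lean` + the closing module
`Theorems/RootDecompAEDoublesShadowTwoStubGradeTwoDichotomy.lean`, one namespace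
`Summit.SmoothPoincare4.SmoothPoincare4.Theorems.RootDecompAEDoublesShadowTwoStubGradeTwoDichotomy`, chained imports,
split by topic to respect the 400-line bound on proof files; the local-table parts import only `…RoeDefs`).
-/

open Function
open Literature.Topology.FourManifolds

set_option linter.dupNamespace false

noncomputable section

namespace Summit.SmoothPoincare4.SmoothPoincare4.Theorems.RootDecompAEDoublesShadowTwoStubGradeTwoDichotomy

/-! ## §3 Unimodular square blocks of an integer table, indexed by finsets of rows and columns

`UM a rows cols`: for SOME (equivalently EVERY) bijection `rows ≃ cols`, the square block `(a r (β c))` has unit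
determinant.  Block-triangular shapes split `UM` into the two diagonal blocks (`Matrix.det_fromBlocks_zero₂₁/₁₂`);
a block with a zero row or a zero column is not unimodular; blocks of size one and two are evaluated. -/

section UMat

variable {ρ γ : Type} [DecidableEq ρ] [DecidableEq γ] (a : ρ → γ → ℤ)

/-- The square block of the table `a` on `rows × cols`, columns re-indexed by rows along `β`. -/
def blk (rows : Finset ρ) (cols : Finset γ) (β : rows ≃ cols) : Matrix rows rows ℤ :=
  Matrix.of fun i j => a (i : ρ) ((β j : cols) : γ)

/-- UNIMODULARITY of the block `rows × cols` of the table `a`. -/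
def UM (rows : Finset ρ) (cols : Finset γ) : Prop := ∃ β : rows ≃ cols, IsUnit (blk a rows cols β).det

variable {a}

omit [DecidableEq γ] in
/-- A unimodular block is square: its row and column index sets have the same size. -/
theorem UM.card_eq {rows : Finset ρ} {cols : Finset γ} (h : UM a rows cols) : rows.card = cols.card := by
  obtain ⟨β, -⟩ := h
  simpa using Fintype.card_congr β

omit [DecidableEq γ] in
/-- Unimodularity does not depend on the bijection used to square the block. -/
theorem UM.isUnit_any {rows : Finset ρ} {cols : Finset γ} (h : UM a rows cols) (β : rows ≃ cols) :
    IsUnit (blk a rows cols β).det := by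
  obtain ⟨β₀, h₀⟩ := h
  have e : blk a rows cols β = (blk a rows cols β₀).submatrix id (β.trans β₀.symm) := by
    ext i j
    simp [blk]
  rw [e, Matrix.det_permute']
  exact (Units.isUnit _).mul h₀

omit [DecidableEq γ] in
/-- Transport of `UM` along a re-indexing of the rows. -/
theorem UM.of_rowEquiv {ρ' : Type} [DecidableEq ρ'] {a' : ρ' → γ → ℤ} {rows : Finset ρ} {rows' : Finset ρ'}
    {cols : Finset γ} (f : rows' ≃ rows) (hf : ∀ (i : rows') (j : γ), a' (i : ρ') j = a (f i : ρ) j)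
    (h : UM a rows cols) : UM a' rows' cols := by
  obtain ⟨β, hβ⟩ := h
  refine ⟨f.trans β, ?_⟩
  have e : blk a' rows' cols (f.trans β) = (blk a rows cols β).submatrix f f := by
    ext i j
    simp [blk, hf]
  rw [e, Matrix.det_submatrix_equiv_self]
  exact hβ

/-- BLOCK SPLITTING, upper shape: if the rows `r'` vanish on the columns `cu`, then the block `(ru ⊔ r') × (cu ⊔ c')`
is unimodular only if both `ru × cu` and `r' × c'` are. -/
theorem UM.split_top {ru r' : Finset ρ} {cu c' : Finset γ} (hdr : Disjoint ru r') (hdc : Disjoint cu c')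
    (hcard : ru.card = cu.card) (hz : ∀ i ∈ r', ∀ j ∈ cu, a i j = 0) (h : UM a (ru ∪ r') (cu ∪ c')) :
    UM a ru cu ∧ UM a r' c' := by
  classical
  have hcard' : r'.card = c'.card := by
    have := h.card_eq
    rw [Finset.card_union_of_disjoint hdr, Finset.card_union_of_disjoint hdc] at this
    omega
  obtain ⟨βu⟩ : Nonempty (ru ≃ cu) := ⟨Fintype.equivOfCardEq (by simpa using hcard)⟩
  obtain ⟨β'⟩ : Nonempty (r' ≃ c') := ⟨Fintype.equivOfCardEq (by simpa using hcard')⟩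
  let eR : ru ⊕ r' ≃ (ru ∪ r' : Finset ρ) := Equiv.Finset.union ru r' hdr
  let eC : cu ⊕ c' ≃ (cu ∪ c' : Finset γ) := Equiv.Finset.union cu c' hdc
  let β : (ru ∪ r' : Finset ρ) ≃ (cu ∪ c' : Finset γ) := eR.symm.trans ((βu.sumCongr β').trans eC)
  have hβ := h.isUnit_any β
  have e : (blk a (ru ∪ r') (cu ∪ c') β).submatrix eR eR =
      Matrix.fromBlocks (blk a ru cu βu) (Matrix.of fun (i : ru) (j : r') => a (i : ρ) ((β' j : c') : γ)) 0
        (blk a r' c' β') := by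
    ext x y
    rcases x with i | i <;> rcases y with j | j
    · simp [blk, β, eR, eC]
    · simp [blk, β, eR, eC]
    · simpa [blk, β, eR, eC] using hz _ i.2 _ (βu j).2
    · simp [blk, β, eR, eC]
  have hdet : (blk a (ru ∪ r') (cu ∪ c') β).det = (blk a ru cu βu).det * (blk a r' c' β').det := by
    rw [← Matrix.det_submatrix_equiv_self eR, e, Matrix.det_fromBlocks_zero₂₁]
  rw [hdet] at hβ
  exact ⟨⟨βu, (IsUnit.mul_iff.mp hβ).1⟩, ⟨β', (IsUnit.mul_iff.mp hβ).2⟩⟩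

/-- BLOCK SPLITTING, lower shape: if the rows `ru` vanish on the columns `c'`, then the block `(ru ⊔ r') × (cu ⊔ c')`
is unimodular only if both `ru × cu` and `r' × c'` are. -/
theorem UM.split_bot {ru r' : Finset ρ} {cu c' : Finset γ} (hdr : Disjoint ru r') (hdc : Disjoint cu c')
    (hcard : ru.card = cu.card) (hz : ∀ i ∈ ru, ∀ j ∈ c', a i j = 0) (h : UM a (ru ∪ r') (cu ∪ c')) :
    UM a ru cu ∧ UM a r' c' := by
  classical
  have hcard' : r'.card = c'.card := by
    have := h.card_eq
    rw [Finset.card_union_of_disjoint hdr, Finset.card_union_of_disjoint hdc] at this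
    omega
  obtain ⟨βu⟩ : Nonempty (ru ≃ cu) := ⟨Fintype.equivOfCardEq (by simpa using hcard)⟩
  obtain ⟨β'⟩ : Nonempty (r' ≃ c') := ⟨Fintype.equivOfCardEq (by simpa using hcard')⟩
  let eR : ru ⊕ r' ≃ (ru ∪ r' : Finset ρ) := Equiv.Finset.union ru r' hdr
  let eC : cu ⊕ c' ≃ (cu ∪ c' : Finset γ) := Equiv.Finset.union cu c' hdc
  let β : (ru ∪ r' : Finset ρ) ≃ (cu ∪ c' : Finset γ) := eR.symm.trans ((βu.sumCongr β').trans eC)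
  have hβ := h.isUnit_any β
  have e : (blk a (ru ∪ r') (cu ∪ c') β).submatrix eR eR =
      Matrix.fromBlocks (blk a ru cu βu) 0 (Matrix.of fun (i : r') (j : ru) => a (i : ρ) ((βu j : cu) : γ))
        (blk a r' c' β') := by
    ext x y
    rcases x with i | i <;> rcases y with j | j
    · simp [blk, β, eR, eC]
    · simpa [blk, β, eR, eC] using hz _ i.2 _ (β' j).2
    · simp [blk, β, eR, eC]
    · simp [blk, β, eR, eC]
  have hdet : (blk a (ru ∪ r') (cu ∪ c') β).det = (blk a ru cu βu).det * (blk a r' c' β').det := by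
    rw [← Matrix.det_submatrix_equiv_self eR, e, Matrix.det_fromBlocks_zero₁₂]
  rw [hdet] at hβ
  exact ⟨⟨βu, (IsUnit.mul_iff.mp hβ).1⟩, ⟨β', (IsUnit.mul_iff.mp hβ).2⟩⟩

omit [DecidableEq γ] in
/-- A unimodular `1 × 1` block: its entry is `±1`. -/
theorem UM.isUnit_entry {i : ρ} {j : γ} (h : UM a {i} {j}) : IsUnit (a i j) := by
  obtain ⟨β, hβ⟩ := h
  have hβi : ((β ⟨i, Finset.mem_singleton_self i⟩ : ({j} : Finset γ)) : γ) = j :=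
    Finset.mem_singleton.mp (β ⟨i, Finset.mem_singleton_self i⟩).2
  rw [Matrix.det_eq_elem_of_card_eq_one (by simp) ⟨i, Finset.mem_singleton_self i⟩] at hβ
  have e : blk a {i} {j} β ⟨i, Finset.mem_singleton_self i⟩ ⟨i, Finset.mem_singleton_self i⟩ = a i j := by
    change a i ((β ⟨i, Finset.mem_singleton_self i⟩ : ({j} : Finset γ)) : γ) = a i j
    rw [hβi]
  rwa [e] at hβ

/-- An explicit equivalence `Fin 2 ≃ {i₁, i₂}`. -/
def finTwoEquivPair (i₁ i₂ : ρ) (h : i₁ ≠ i₂) : Fin 2 ≃ (({i₁, i₂} : Finset ρ) : Type) where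
  toFun x := if x = 0 then ⟨i₁, by simp⟩ else ⟨i₂, by simp⟩
  invFun y := if (y : ρ) = i₁ then 0 else 1
  left_inv x := by
    rcases Fin.exists_fin_two.mp ⟨x, rfl⟩ with rfl | rfl
    · simp
    · simp [Ne.symm h]
  right_inv y := by
    obtain ⟨y, hy⟩ := y
    simp only [Finset.mem_insert, Finset.mem_singleton] at hy
    rcases hy with rfl | rfl
    · simp
    · simp [Ne.symm h]

/-- A unimodular `2 × 2` block: `a i₁ j₁ · a i₂ j₂ − a i₁ j₂ · a i₂ j₁ = ±1`. -/
theorem UM.isUnit_det2 {i₁ i₂ : ρ} {j₁ j₂ : γ} (hi : i₁ ≠ i₂) (hj : j₁ ≠ j₂) (h : UM a {i₁, i₂} {j₁, j₂}) :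
    IsUnit (a i₁ j₁ * a i₂ j₂ - a i₁ j₂ * a i₂ j₁) := by
  classical
  -- square the block with the bijection `i₁ ↦ j₁, i₂ ↦ j₂`
  let β : (({i₁, i₂} : Finset ρ) : Type) ≃ (({j₁, j₂} : Finset γ) : Type) :=
    (finTwoEquivPair i₁ i₂ hi).symm.trans (finTwoEquivPair j₁ j₂ hj)
  have hβ := h.isUnit_any β
  rw [← Matrix.det_submatrix_equiv_self (finTwoEquivPair i₁ i₂ hi), Matrix.det_fin_two] at hβ
  have h0 : ((finTwoEquivPair i₁ i₂ hi) 0 : ρ) = i₁ := by simp [finTwoEquivPair]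
  have h1 : ((finTwoEquivPair i₁ i₂ hi) 1 : ρ) = i₂ := by simp [finTwoEquivPair]
  have hb0 : ((β ((finTwoEquivPair i₁ i₂ hi) 0) : ({j₁, j₂} : Finset γ)) : γ) = j₁ := by
    simp [β, finTwoEquivPair]
  have hb1 : ((β ((finTwoEquivPair i₁ i₂ hi) 1) : ({j₁, j₂} : Finset γ)) : γ) = j₂ := by
    simp [β, finTwoEquivPair, Ne.symm hi]
  have e00 : (blk a {i₁, i₂} {j₁, j₂} β).submatrix (finTwoEquivPair i₁ i₂ hi) (finTwoEquivPair i₁ i₂ hi) 0 0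
      = a i₁ j₁ := by
    change a ((finTwoEquivPair i₁ i₂ hi) 0 : ρ) ((β ((finTwoEquivPair i₁ i₂ hi) 0) : ({j₁, j₂} : Finset γ)) : γ) = _
    rw [hb0, h0]
  have e01 : (blk a {i₁, i₂} {j₁, j₂} β).submatrix (finTwoEquivPair i₁ i₂ hi) (finTwoEquivPair i₁ i₂ hi) 0 1
      = a i₁ j₂ := by
    change a ((finTwoEquivPair i₁ i₂ hi) 0 : ρ) ((β ((finTwoEquivPair i₁ i₂ hi) 1) : ({j₁, j₂} : Finset γ)) : γ) = _
    rw [hb1, h0]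
  have e10 : (blk a {i₁, i₂} {j₁, j₂} β).submatrix (finTwoEquivPair i₁ i₂ hi) (finTwoEquivPair i₁ i₂ hi) 1 0
      = a i₂ j₁ := by
    change a ((finTwoEquivPair i₁ i₂ hi) 1 : ρ) ((β ((finTwoEquivPair i₁ i₂ hi) 0) : ({j₁, j₂} : Finset γ)) : γ) = _
    rw [hb0, h1]
  have e11 : (blk a {i₁, i₂} {j₁, j₂} β).submatrix (finTwoEquivPair i₁ i₂ hi) (finTwoEquivPair i₁ i₂ hi) 1 1
      = a i₂ j₂ := by
    change a ((finTwoEquivPair i₁ i₂ hi) 1 : ρ) ((β ((finTwoEquivPair i₁ i₂ hi) 1) : ({j₁, j₂} : Finset γ)) : γ) = _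
    rw [hb1, h1]
  rw [e00, e01, e10, e11] at hβ
  exact hβ

end UMat

section UMatRank

variable {ρ γ : Type} [DecidableEq ρ] [DecidableEq γ] {a : ρ → γ → ℤ}

omit [DecidableEq γ] in
/-- RANK BOUND: rows of a unimodular block that are supported in a set of columns `cu` are at most `#cu` many
(every permutation term of the determinant would otherwise contain a zero factor). -/
theorem UM.card_le_of_rows_supported {rows ru : Finset ρ} {cols cu : Finset γ} (h : UM a rows cols)
    (hru : ru ⊆ rows) (hz : ∀ i ∈ ru, ∀ j ∈ cols, j ∉ cu → a i j = 0) : ru.card ≤ cu.card := by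
  classical
  obtain ⟨β, hβ⟩ := h
  by_contra hlt
  push Not at hlt
  have hdet : (blk a rows cols β).det = 0 := by
    rw [← Matrix.det_transpose, Matrix.det_apply]
    refine Finset.sum_eq_zero fun σ _ => ?_
    have hex : ∃ i : rows, (i : ρ) ∈ ru ∧ ((β (σ i) : cols) : γ) ∉ cu := by
      by_contra hno
      push Not at hno
      let f : ru → γ := fun x => ((β (σ ⟨(x : ρ), hru x.2⟩) : cols) : γ)
      have hf : Function.Injective f := by
        intro x y hxy
        change ((β (σ ⟨(x : ρ), hru x.2⟩) : cols) : γ) = ((β (σ ⟨(y : ρ), hru y.2⟩) : cols) : γ) at hxy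
        have h1 : β (σ ⟨(x : ρ), hru x.2⟩) = β (σ ⟨(y : ρ), hru y.2⟩) := Subtype.ext hxy
        have h2 := σ.injective (β.injective h1)
        exact Subtype.ext (congrArg Subtype.val h2 :)
      have hsub : (Finset.univ.image f) ⊆ cu := by
        intro j hj
        obtain ⟨x, -, rfl⟩ := Finset.mem_image.mp hj
        exact hno ⟨(x : ρ), hru x.2⟩ x.2
      have := Finset.card_le_card hsub
      rw [Finset.card_image_of_injective _ hf, Finset.card_univ, Fintype.card_coe] at this
      omega
    obtain ⟨i, hi, hic⟩ := hex
    rw [Finset.prod_eq_zero (Finset.mem_univ i)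
      (by simpa [Matrix.transpose_apply, blk] using hz _ hi _ (β (σ i)).2 hic)]
    simp
  rw [hdet] at hβ
  exact not_isUnit_zero hβ

/-- Transposing the table exchanges the roles of rows and columns. -/
theorem UM.transpose {rows : Finset ρ} {cols : Finset γ} (h : UM a rows cols) :
    UM (fun j i => a i j) cols rows := by
  obtain ⟨β, hβ⟩ := h
  refine ⟨β.symm, ?_⟩
  have e : blk (fun j i => a i j) cols rows β.symm = ((blk a rows cols β).submatrix β.symm β.symm).transpose := by
    ext j j'
    simp [blk]
  rw [e, Matrix.det_transpose, Matrix.det_submatrix_equiv_self]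
  exact hβ

omit [DecidableEq ρ] in
/-- RANK BOUND, column form: columns of a unimodular block supported in a set of rows `ru` are at most `#ru` many. -/
theorem UM.card_le_of_cols_supported [DecidableEq ρ] {rows ru : Finset ρ} {cols cu : Finset γ} (h : UM a rows cols)
    (hcu : cu ⊆ cols) (hz : ∀ j ∈ cu, ∀ i ∈ rows, i ∉ ru → a i j = 0) : cu.card ≤ ru.card :=
  h.transpose.card_le_of_rows_supported hcu hz

end UMatRank

section UMatEnum

variable {ρ γ : Type} [DecidableEq ρ] [DecidableEq γ] {a : ρ → γ → ℤ}

omit [DecidableEq γ] in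
/-- SQUARING a unimodular block along explicit enumerations of its rows and columns: the explicit square matrix has
unit determinant. -/
theorem UM.isUnit_det_enum {r : ℕ} {rows : Finset ρ} {cols : Finset γ} (h : UM a rows cols) (f : Fin r → ρ)
    (g : Fin r → γ) (hf : Function.Injective f) (hg : Function.Injective g) (hfr : ∀ i, f i ∈ rows)
    (hgc : ∀ i, g i ∈ cols) (hr : rows.card = r) : IsUnit (Matrix.of fun i j => a (f i) (g j)).det := by
  classical
  have hc : cols.card = r := h.card_eq ▸ hr
  have hbf : Function.Bijective fun i : Fin r => (⟨f i, hfr i⟩ : rows) := by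
    rw [Fintype.bijective_iff_injective_and_card]
    exact ⟨fun i j hij => hf (congrArg Subtype.val hij), by simp [hr]⟩
  have hbg : Function.Bijective fun i : Fin r => (⟨g i, hgc i⟩ : cols) := by
    rw [Fintype.bijective_iff_injective_and_card]
    exact ⟨fun i j hij => hg (congrArg Subtype.val hij), by simp [hc]⟩
  have hβ := h.isUnit_any ((Equiv.ofBijective _ hbf).symm.trans (Equiv.ofBijective _ hbg))
  rw [← Matrix.det_submatrix_equiv_self (Equiv.ofBijective _ hbf)] at hβ
  have e : (blk a rows cols ((Equiv.ofBijective _ hbf).symm.trans (Equiv.ofBijective _ hbg))).submatrix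
      (Equiv.ofBijective _ hbf) (Equiv.ofBijective _ hbf) = Matrix.of fun i j => a (f i) (g j) := by
    ext i j
    simp [blk]
  rwa [e] at hβ

end UMatEnum

namespace ShadowGraph

variable (G₂ : ShadowGraph)

/-- The unordered pair of pieces joined by the `e`-th gluing. -/
def epair (e : Fin G₂.m) : Sym2 (Fin G₂.k) := s((G₂.src e).1, (G₂.tgt e).1)

/-- Adjacency in the tree graph: distinct pieces joined by a tree gluing. -/
theorem treeAdj_iff₂ (u v : Fin G₂.k) :
    G₂.treeAdj.Adj u v ↔ u ≠ v ∧ ∃ e : Fin G₂.m, G₂.tree e = true ∧ G₂.epair e = s(u, v) := by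
  simp only [ShadowGraph.treeAdj, SimpleGraph.fromRel_adj, epair, Sym2.eq_iff]
  constructor
  · rintro ⟨hne, ⟨e, he, h1, h2⟩ | ⟨e, he, h1, h2⟩⟩
    · exact ⟨hne, e, he, Or.inl ⟨h1, h2⟩⟩
    · exact ⟨hne, e, he, Or.inr ⟨h1, h2⟩⟩
  · rintro ⟨hne, e, he, ⟨h1, h2⟩ | ⟨h1, h2⟩⟩
    · exact ⟨hne, Or.inl ⟨e, he, h1, h2⟩⟩
    · exact ⟨hne, Or.inr ⟨e, he, h1, h2⟩⟩

/-- With all edges in the spanning tree there are `k − 1 = m` edges, the end-piece pairs of distinct edges are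
distinct, and `treeAdj` is a tree. -/
theorem tree_facts₂ (hT : G₂.IsSpanningTree) (hall : ∀ e, G₂.tree e = true) :
    G₂.m + 1 = G₂.k ∧ Function.Injective G₂.epair ∧ G₂.treeAdj.IsTree := by
  classical
  obtain ⟨-, hconn, hcard⟩ := hT
  have hfilt : (Finset.univ.filter fun e => G₂.tree e = true) = Finset.univ :=
    Finset.filter_true_of_mem fun e _ => hall e
  rw [hfilt, Finset.card_univ, Fintype.card_fin] at hcard
  have hsub : G₂.treeAdj.edgeFinset ⊆ Finset.univ.image G₂.epair := by
    intro p hp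
    induction p using Sym2.ind with
    | _ u v =>
      rw [SimpleGraph.mem_edgeFinset, SimpleGraph.mem_edgeSet] at hp
      obtain ⟨-, e, -, he⟩ := (G₂.treeAdj_iff₂ u v).mp hp
      exact Finset.mem_image.mpr ⟨e, Finset.mem_univ _, he⟩
  have h1 : Nat.card (Fin G₂.k) ≤ Nat.card G₂.treeAdj.edgeSet + 1 := hconn.card_vert_le_card_edgeSet_add_one
  rw [Nat.card_eq_fintype_card, Fintype.card_fin, Nat.card_eq_fintype_card, ← SimpleGraph.edgeFinset_card] at h1
  have h2 : (Finset.univ.image G₂.epair).card ≤ G₂.m := by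
    simpa using (Finset.card_image_le : (Finset.univ.image G₂.epair).card ≤ _)
  have h3 := Finset.card_le_card hsub
  have hinj : Set.InjOn G₂.epair ↑(Finset.univ : Finset (Fin G₂.m)) :=
    Finset.card_image_iff.mp (by rw [Finset.card_univ, Fintype.card_fin]; omega)
  refine ⟨hcard, fun e₁ e₂ h => hinj (by simp) (by simp) h, ?_⟩
  rw [SimpleGraph.isTree_iff_connected_and_card]
  refine ⟨hconn, ?_⟩
  rw [Nat.card_eq_fintype_card, Nat.card_eq_fintype_card, Fintype.card_fin, ← SimpleGraph.edgeFinset_card]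
  omega

/-- A sub-tree (a set of pieces inducing a connected subgraph) with at least two pieces has a LEAF `u`: a piece
with exactly one tree-neighbour `z` inside the set, whose removal leaves the set connected. -/
theorem exists_leaf₂ (hT : G₂.IsSpanningTree) (hall : ∀ e, G₂.tree e = true) (R : Finset (Fin G₂.k))
    (hconn : (G₂.treeAdj.induce (R : Set (Fin G₂.k))).Connected) (h2 : 2 ≤ R.card) :
    ∃ u ∈ R, ∃ z ∈ R, u ≠ z ∧ G₂.treeAdj.Adj u z ∧ (∀ w ∈ R, G₂.treeAdj.Adj u w → w = z) ∧
      (G₂.treeAdj.induce ((R.erase u : Finset (Fin G₂.k)) : Set (Fin G₂.k))).Connected := by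
  classical
  set H := G₂.treeAdj.induce (R : Set (Fin G₂.k)) with hH
  have hac : H.IsAcyclic := (G₂.tree_facts₂ hT hall).2.2.isAcyclic.induce _
  haveI : Nontrivial (R : Set (Fin G₂.k)) := by
    have : 1 < Fintype.card (R : Set (Fin G₂.k)) := by simp; omega
    exact Fintype.one_lt_card_iff_nontrivial.mp this
  have htree : H.IsTree := ⟨hconn, hac⟩
  obtain ⟨x, hx⟩ := htree.exists_vert_degree_one_of_nontrivial
  obtain ⟨y, hxy, huniq⟩ := SimpleGraph.degree_eq_one_iff_existsUnique_adj.mp hx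
  refine ⟨x, x.2, y, y.2, ?_, hxy, ?_, ?_⟩
  · intro h
    exact hxy.ne (Subtype.ext h)
  · intro w hw hadj
    have := huniq ⟨w, hw⟩ hadj
    exact congrArg Subtype.val this
  · have hc := hconn.induce_compl_singleton_of_degree_eq_one hx
    let φ : (H.induce ({x}ᶜ : Set _)) →g G₂.treeAdj.induce ((R.erase (x : Fin G₂.k) : Finset (Fin G₂.k)) : Set (Fin G₂.k)) :=
      { toFun := fun w => ⟨(w.1 : Fin G₂.k), by
          have hw := w.2
          simp only [Set.mem_compl_iff, Set.mem_singleton_iff] at hw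
          simp only [Finset.coe_erase, Set.mem_sdiff, Finset.mem_coe, Set.mem_singleton_iff]
          exact ⟨w.1.2, fun h => hw (Subtype.ext h)⟩⟩
        map_rel' := fun h => h }
    refine hc.map φ ?_
    rintro ⟨w, hw⟩
    have hw' := hw
    simp only [Finset.coe_erase, Set.mem_sdiff, Finset.mem_coe, Set.mem_singleton_iff] at hw'
    exact ⟨⟨⟨w, hw'.1⟩, fun h => hw'.2 (congrArg Subtype.val (Set.mem_singleton_iff.mp h))⟩, rfl⟩

/-- The whole set of pieces induces a connected subgraph. -/
theorem induce_univ_connected₂ (hT : G₂.IsSpanningTree) :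
    (G₂.treeAdj.induce ((Finset.univ : Finset (Fin G₂.k)) : Set (Fin G₂.k))).Connected := by
  let φ : G₂.treeAdj →g G₂.treeAdj.induce ((Finset.univ : Finset (Fin G₂.k)) : Set (Fin G₂.k)) :=
    { toFun := fun v => ⟨v, by simp⟩
      map_rel' := fun h => h }
  exact hT.2.1.map φ fun w => ⟨w.1, rfl⟩

end ShadowGraph

end Summit.SmoothPoincare4.SmoothPoincare4.Theorems.RootDecompAEDoublesShadowTwoStubGradeTwoDichotomy
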